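import Summits.BirchSwinnertonDyer.BirchSwinnertonDyer.Theorems.Rank2Observatory2DescClFieldCertE2Q2
import Summits.BirchSwinnertonDyer.BirchSwinnertonDyer.Theorems.Rank2Observatory2DescClCurveCertE2Defs
import Summits.BirchSwinnertonDyer.BirchSwinnertonDyer.Theorems.Rank2Observatory2DescClKillRowCert
import Summits.BirchSwinnertonDyer.BirchSwinnertonDyer.Theorems.Rank2Observatory2DescKillValid
import HarnessLib

/-!
# BirchSwinnertonDyer — rank ≥ 2 observatory: KERNEL-2DESC-CL E2Q2 — the TWO-VIEW per-curve certificate over a two-prime record, part 4/8: records and checkers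

HONEST FRAMING: per-curve certified theorems and census instruments; no claim on BSD in rank ≥ 2.

The two-view per-curve layer of v2.3/v2.7/v3.7 (`…2DescClCurveCertE2Defs`, `…2DescClKillCurveCertE2Defs`,
`…E2VDefs`) over the two-view TWO-PRIME field record `ClFieldCertEQ` of part 3, with the family shape of Q2
(`…2DescClCurveCertQ2`): every element the certificate names — the 2-division root `e`, `D = F′(e)`, the whole
`T`-unit family — is a TWO-VIEW ELEMENT `x` given by `X = m₁·x ∈ ℤ[α]` and `Y = m₂·x ∈ ℤ[η]` (`m₁ = r₁²` a
square prime to `q₁`, `q₂` and the `α`-row primes, `m₂` prime to the `η`-row primes, `s m₁ + t m₂ = 1`);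
membership and valuation at a prime above `p` are read in the view whose multiplier is prime to `p`
(`alpha_dispatch` / `eta_dispatch` of `…2DescClEtaCert`).  The support is `T = {W₁₁, W₁₂, W₂₁, W₂₂} ∪` code
primes (tagged by view); the head of the family has SIX entries `−1, ε, γ₁, γ₂, q₁, q₂` (kinds: `1` = the
element `q₁`, `4` = the element `q₂`, anything else generic with certified `ord_{W₁₁}`, `ord_{W₂₁}` packed as
`e = e₁ + 64·e₂` and `invCert` data excluding it from `W₁₂`, `W₂₂`); the sieve has FOUR valuation-parity rows;
the parity certificate has `#chars + 5` rows.  The kill list is carried in VALIDITY form from the start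
(`KillValidE2Q`, `TwoDescKill.KillValidAt` of `…2DescKillValid`; an empty list is the plain sieve), over the
landed raw-kill record `ClKill` (`…2DescClKillRowCert`).  This part: records `ClFieldCertE2Q` (= `ClFieldCertEQ`
+ `r₁, m₂` + Bezout), `FamEntry2Q`, `ClCurveCertE2Q`; checkers `famCheckE2Q`, `adm2Q`, the kill clauses, and
the per-curve `r`-checker `checkE2Q r ks`.  New declarations only.
[cite: Cassels1991LecturesEllipticCurves, §15] [cite: CremonaAlgorithms1997, §3.6] [cite: Cohen1993, §4.8.2, §6.2, §6.5]
-/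

set_option linter.dupNamespace false

noncomputable section

open scoped Classical NumberField nonZeroDivisors

open Literature.NumberTheory.NumberFields Polynomial Module NumberField IsDedekindDomain Ideal

namespace Summit.BirchSwinnertonDyer.BirchSwinnertonDyer.Rank2Observatory.TwoDescCl

open TwoDescCubic ClFieldCertQ2 TwoDescKill

/-! ## Small algebra

DEDUPFIX (cert-1 gen 36): the two `lin` lemmas formerly here (`lin_smulCoordsZ`, `lin_constZ`) were, header and proof,
the landed `TwoDescCl.lin_smulCoords` / `TwoDescCl.lin_const` of `…2DescClCurveCertE2Defs`; that module is imported and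
the landed lemmas are used by name in parts 6/8 and 7/8. -/

/-! ## Records -/
/-- **Two-view two-prime field constants**: the two-view two-prime field record plus the multipliers `m₁ = r₁²`
(kills `𝓞 K / ℤ[α]`, a square), `m₂` (kills `𝓞 K / ℤ[η]`) and a Bezout pair `s m₁ + t m₂ = 1`. Pure data. -/
structure ClFieldCertE2Q where
  /-- the two-view two-prime field record -/
  fe : ClFieldCertEQ
  /-- `m₁ = r₁²` -/
  r₁ : ℕ
  /-- the `η`-multiplier -/
  m₂ : ℕ
  /-- Bezout: `s m₁ + t m₂ = 1` -/
  s : ℤ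
  /-- Bezout: `s m₁ + t m₂ = 1` -/
  t : ℤ

namespace ClFieldCertE2Q

/-- `m₁ = r₁²`. -/
def m₁ (F : ClFieldCertE2Q) : ℕ := F.r₁ ^ 2

/-- **Constants clause**: Bezout, `0 < r₁`, `m₁` prime to `q₁`, to `q₂` and to every `α`-row prime, `m₂` prime
to every `η`-row prime. Computable. -/
def checkConst (F : ClFieldCertE2Q) : Bool :=
  bezoutCheck F.s F.t F.m₁ F.m₂ && decide (0 < F.r₁) && decide (Nat.Coprime F.m₁ F.fe.base.q₁) &&
    decide (Nat.Coprime F.m₁ F.fe.base.q₂) &&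
    (F.fe.base.primes.all fun e => decide (Nat.Coprime F.m₁ e.p)) &&
    (F.fe.primesE.all fun e => decide (Nat.Coprime F.m₂ e.p))

/-- **The complex two-view two-prime field checker with constants.** Computable; `decide +kernel` once per field. -/
def check2 (F : ClFieldCertE2Q) : Bool := F.fe.checkE && F.checkConst

variable (F : ClFieldCertE2Q)

/-- The two-view field clause of a checked record-with-multipliers. -/
theorem checkE_of_check2 (F : ClFieldCertE2Q) (h : F.check2 = true) : F.fe.checkE = true := by
  simp only [check2, Bool.and_eq_true] at h; exact h.1

/-- The multiplier/Bezout clause of a checked record-with-multipliers. -/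
theorem const_of_check2 (F : ClFieldCertE2Q) (h : F.check2 = true) : F.checkConst = true := by
  simp only [check2, Bool.and_eq_true] at h; exact h.2

/-- The Bezout identity `s·m₁ + t·m₂ = 1`. -/
theorem bezout_of_const (F : ClFieldCertE2Q) (hK : F.checkConst = true) : bezoutCheck F.s F.t F.m₁ F.m₂ = true := by
  simp only [checkConst, Bool.and_eq_true] at hK; exact hK.1.1.1.1.1

/-- `0 < r₁`. -/
theorem r₁_pos (F : ClFieldCertE2Q) (hK : F.checkConst = true) : 0 < F.r₁ := by
  simp only [checkConst, Bool.and_eq_true, decide_eq_true_eq] at hK; exact hK.1.1.1.1.2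

/-- `0 < m₁ = r₁²`. -/
theorem m₁_pos (F : ClFieldCertE2Q) (hK : F.checkConst = true) : 0 < F.m₁ := pow_pos (F.r₁_pos hK) 2

/-- `m₁` is prime to `q₁`. -/
theorem coprime_q₁ (hK : F.checkConst = true) : Nat.Coprime F.m₁ F.fe.base.q₁ := by
  simp only [checkConst, Bool.and_eq_true, decide_eq_true_eq] at hK; exact hK.1.1.1.2

/-- `m₁` is prime to `q₂`. -/
theorem coprime_q₂ (hK : F.checkConst = true) : Nat.Coprime F.m₁ F.fe.base.q₂ := by
  simp only [checkConst, Bool.and_eq_true, decide_eq_true_eq] at hK; exact hK.1.1.2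

/-- `m₁` is prime to every `α`-row prime. -/
theorem coprime_row (F : ClFieldCertE2Q) (hK : F.checkConst = true) {e : PrimeEntry} (he : e ∈ F.fe.base.primes) :
    Nat.Coprime F.m₁ e.p := by
  simp only [checkConst, Bool.and_eq_true, decide_eq_true_eq, List.all_eq_true] at hK; exact hK.1.2 e he

/-- `m₂` is prime to every `η`-row prime. -/
theorem coprime_rowE (F : ClFieldCertE2Q) (hK : F.checkConst = true) {e : PrimeEntry} (he : e ∈ F.fe.primesE) :
    Nat.Coprime F.m₂ e.p := by
  simp only [checkConst, Bool.and_eq_true, decide_eq_true_eq, List.all_eq_true] at hK; exact hK.2 e he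

end ClFieldCertE2Q

/-- **A two-view family entry (two primes)**: `kind` (`1` = the element `q₁`, `4` = the element `q₂`, anything
else generic), `X = m₁x` in `α`-coordinates, `Y = m₂x` in `η`-coordinates, the sign bit, `e = ord_{W₁₁}(x) +
64·ord_{W₂₁}(x)`, the `invCert` data at `w₁₂` and `w₂₂`, the factorisation `nf` of `|N(X)|`, and the `invCert`
data excluding `x` from non-support code primes in each view. Pure data. -/
structure FamEntry2Q where
  /-- `1` = the element `q₁`; `4` = the element `q₂`; otherwise generic -/
  kind : ℕ
  /-- `m₁ · x` in `α`-coordinates -/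
  X : ℤ × ℤ × ℤ
  /-- `m₂ · x` in `η`-coordinates -/
  Y : ℤ × ℤ × ℤ
  /-- sign bit at the real place (`true` = negative) -/
  sg : Bool
  /-- `ord_{W₁₁}(x) + 64 · ord_{W₂₁}(x)` -/
  e : ℕ
  /-- `invCert` datum: `X ∉ W₁₂` -/
  inv12 : ℤ × ℤ × ℤ
  /-- `invCert` datum: `X ∉ W₂₂` -/
  inv22 : ℤ × ℤ × ℤ
  /-- factorisation of `|N(X)|` -/
  nf : List (ℕ × ℕ)
  /-- `α`-view exclusions `(code, invCert datum)` -/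
  invsA : List (PCode × (ℤ × ℤ × ℤ))
  /-- `η`-view exclusions `(code, invCert datum)` -/
  invsE : List (PCode × (ℤ × ℤ × ℤ))

/-- **Two-view per-curve certificate (two primes)** for `y² = x³ + Ax² + Bx + C`: the 2-division root `e` and
`D = F′(e)` as two-view elements, the factorisation of `|N(X_D)|` with exclusions, the `invCert` data of `X_D` at
`w₁₁, w₁₂, w₂₁, w₂₂`, the sieve moduli, the six head entries `−1, ε, γ₁, γ₂, q₁, q₂` of the family, and the support
codes TAGGED by view (`true` = `α`) each WITH its family element. Pure data. [cite: Cassels1991LecturesEllipticCurves, §15] -/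
structure ClCurveCertE2Q where
  /-- the model `(0, A, 0, B, C)` -/
  A : ℤ
  /-- the model -/
  B : ℤ
  /-- the model -/
  C : ℤ
  /-- irreducibility modulus for `X³ + AX² + BX + C` -/
  pF : ℕ
  /-- `m₁ · e` in `α`-coordinates -/
  Xt : ℤ × ℤ × ℤ
  /-- `m₂ · e` in `η`-coordinates -/
  Yt : ℤ × ℤ × ℤ
  /-- `m₁ · F′(e)` in `α`-coordinates -/
  XD : ℤ × ℤ × ℤ
  /-- `m₂ · F′(e)` in `η`-coordinates -/
  YD : ℤ × ℤ × ℤ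
  /-- factorisation of `|N(X_D)|` -/
  dn : List (ℕ × ℕ)
  /-- `α`-view exclusions for `D` -/
  dinvA : List (PCode × (ℤ × ℤ × ℤ))
  /-- `η`-view exclusions for `D` -/
  dinvE : List (PCode × (ℤ × ℤ × ℤ))
  /-- `invCert` datum: `X_D ∉ W₁₁` -/
  dW11 : ℤ × ℤ × ℤ
  /-- `invCert` datum: `X_D ∉ W₁₂` -/
  dW12 : ℤ × ℤ × ℤ
  /-- `invCert` datum: `X_D ∉ W₂₁` -/
  dW21 : ℤ × ℤ × ℤ
  /-- `invCert` datum: `X_D ∉ W₂₂` -/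
  dW22 : ℤ × ℤ × ℤ
  /-- sieve moduli -/
  Q : List ℕ
  /-- the head of the family: `−1, ε, γ₁, γ₂, q₁, q₂` (six entries) -/
  head : List FamEntry2Q
  /-- the support codes, tagged by view (`true` = `α`), each with its family element -/
  codes : List ((Bool × PCode) × FamEntry2Q)

/-! ## The checkers -/

section Checkers

variable (F : ClFieldCertE2Q) (cc : ClCurveCertE2Q)

/-- The family: head entries then the code elements. -/
def fam2Q : List FamEntry2Q := cc.head ++ cc.codes.map Prod.snd

/-- **Prime dispatch**: the rational prime `p` of a norm factorisation is `q₁` or `q₂`, or has an `α`-row each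
of whose codes is a support code or misses the element (`invCert` on `X`), or has an `η`-row likewise (on `Y`).
Computable. -/
def primeDispatchQ (X Y : ℤ × ℤ × ℤ) (invsA invsE : List (PCode × (ℤ × ℤ × ℤ))) (p : ℕ) : Bool :=
  (p == F.fe.base.q₁) || (p == F.fe.base.q₂) ||
    ((F.fe.base.primes.any fun e => e.p == p) &&
      ((F.fe.base.row p).codes.all fun C' => decide ((true, C') ∈ cc.codes.map Prod.fst) ||
        invsA.any fun ci => ci.1 == C' && invCert F.fe.base.a F.fe.base.b F.fe.base.c C' X ci.2)) ||
    ((F.fe.primesE.any fun e => e.p == p) &&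
      ((F.fe.rowE p).codes.all fun C' => decide ((false, C') ∈ cc.codes.map Prod.fst) ||
        invsE.any fun ci => ci.1 == C' && invCert F.fe.a' F.fe.b' F.fe.c' C' Y ci.2))

/-- **Support-code clause**: the code is present in its view's registry and its prime contains `D`. Computable. -/
def codeClauseQ (bc : (Bool × PCode) × FamEntry2Q) : Bool :=
  if bc.1.1 then
    (F.fe.base.primes.any fun e => e.p == bc.1.2.1) && decide (bc.1.2 ∈ (F.fe.base.row bc.1.2.1).codes) &&
      memCode bc.1.2 cc.XD
  else
    (F.fe.primesE.any fun e => e.p == bc.1.2.1) && decide (bc.1.2 ∈ (F.fe.rowE bc.1.2.1).codes) &&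
      memCode bc.1.2 cc.YD

/-- Kind-specific clause: the element `q₁` is literally `X = (m₁ q₁, 0, 0)`, the element `q₂` is `X = (m₁ q₂, 0, 0)`;
a generic element misses `W₁₂` and `W₂₂` and has certified `ord_{W₁₁}`, `ord_{W₂₁}` (packed in `e`). Computable. -/
def famKindCheck2Q (f : FamEntry2Q) : Bool :=
  if f.kind = 1 then decide (f.X = ((F.m₁ : ℤ) * F.fe.base.q₁, 0, 0))
  else if f.kind = 4 then decide (f.X = ((F.m₁ : ℤ) * F.fe.base.q₂, 0, 0))
  else invCert F.fe.base.a F.fe.base.b F.fe.base.c F.fe.base.w₁₂ f.X f.inv12 &&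
    invCert F.fe.base.a F.fe.base.b F.fe.base.c F.fe.base.w₂₂ f.X f.inv22 &&
    ordCheck F.fe.base.q₁ (normFormZ F.fe.base.a F.fe.base.b F.fe.base.c f.X.1 f.X.2.1 f.X.2.2).natAbs (f.e % 64) &&
    ordCheck F.fe.base.q₂ (normFormZ F.fe.base.a F.fe.base.b F.fe.base.c f.X.1 f.X.2.1 f.X.2.2).natAbs (f.e / 64)

/-- **The two-view family-entry check (two primes).** Computable. [cite: Cassels1991LecturesEllipticCurves, §15] -/
def famCheckE2Q (f : FamEntry2Q) : Bool :=
  twoViewCheck F.fe.base.a F.fe.base.b F.fe.base.c F.fe.u F.fe.d F.m₁ F.m₂ f.X f.Y &&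
    signCond F.fe.base.lo F.fe.base.hi f.X f.sg &&
    decide (normFormZ F.fe.base.a F.fe.base.b F.fe.base.c f.X.1 f.X.2.1 f.X.2.2 ≠ 0) &&
    decide (((F.m₁ : ℤ)) ^ 3 ∣ normFormZ F.fe.base.a F.fe.base.b F.fe.base.c f.X.1 f.X.2.1 f.X.2.2) &&
    (F.fe.base.chars.all fun ch => !decide ((ch.1 : ℤ) ∣ evalInt ch.2.1 f.X)) &&
    decide ((normFormZ F.fe.base.a F.fe.base.b F.fe.base.c f.X.1 f.X.2.1 f.X.2.2).natAbs =
      (f.nf.map fun pe => pe.1 ^ pe.2).prod) &&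
    (f.nf.all fun pe => primeDispatchQ F cc f.X f.Y f.invsA f.invsE pe.1) &&
    famKindCheck2Q F f

/-- `log ord_{W₁₁}`: `−1` for `q₁`, `0` for `q₂`, `−(e mod 64)` otherwise. -/
def famL₁₁Q (f : FamEntry2Q) : ℤ := if f.kind = 1 then -1 else if f.kind = 4 then 0 else -((f.e % 64 : ℕ) : ℤ)

/-- `log ord_{W₁₂}`: `−1` for `q₁`, `0` otherwise. -/
def famL₁₂Q (f : FamEntry2Q) : ℤ := if f.kind = 1 then -1 else 0

/-- `log ord_{W₂₁}`: `0` for `q₁`, `−1` for `q₂`, `−(e div 64)` otherwise. -/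
def famL₂₁Q (f : FamEntry2Q) : ℤ := if f.kind = 1 then 0 else if f.kind = 4 then -1 else -((f.e / 64 : ℕ) : ℤ)

/-- `log ord_{W₂₂}`: `−1` for `q₂`, `0` otherwise. -/
def famL₂₂Q (f : FamEntry2Q) : ℤ := if f.kind = 4 then -1 else 0

/-- Row `k` of the parity matrix at an entry (computed on `X`): `0` sign, `1 … 4` parity of `ord` at `W₁₁, W₁₂,
W₂₁, W₂₂`, `5 + i` the Euler bit of the `i`-th residue character. -/
def bitRow2Q (fc : ClFieldCertQ2) (f : FamEntry2Q) : ℕ → Bool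
  | 0 => f.sg
  | 1 => !decide ((2 : ℤ) ∣ famL₁₁Q f)
  | 2 => !decide ((2 : ℤ) ∣ famL₁₂Q f)
  | 3 => !decide ((2 : ℤ) ∣ famL₂₁Q f)
  | 4 => !decide ((2 : ℤ) ∣ famL₂₂Q f)
  | k + 5 => eulerBit (fc.chars.getD k (3, 0, 0)).1 (evalInt (fc.chars.getD k (3, 0, 0)).2.1 f.X)

/-- The parity matrix. -/
def bit2Q (k : Fin (F.fe.base.chars.length + 5)) (j : Fin (fam2Q cc).length) : Bool :=
  bitRow2Q F.fe.base ((fam2Q cc).get j) k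

/-- The norms of the family (`N(x) = N(X) / m₁³`). -/
def famNorm2Q (j : Fin (fam2Q cc).length) : ℤ :=
  normFormZ F.fe.base.a F.fe.base.b F.fe.base.c ((fam2Q cc).get j).X.1 ((fam2Q cc).get j).X.2.1
    ((fam2Q cc).get j).X.2.2 / (F.m₁ : ℤ) ^ 3

/-- The sign bits of the family. -/
def famSign2Q (j : Fin (fam2Q cc).length) : Bool := ((fam2Q cc).get j).sg

/-- **The sieve** on pairs `(T, U)` (`T = ∅`): norm-square residues modulo `Q`, sign, parities of `ord` at the four
auxiliary primes. -/
def adm2Q (T : Finset (Fin 0)) (U : Finset (Fin (fam2Q cc).length)) : Bool :=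
  admStdQ cc.Q (fun i : Fin 0 => i.elim0) (famNorm2Q F cc) (fun i : Fin 0 => i.elim0) (famSign2Q cc) T U &&
    decide (Even (U.filter fun j => bitRow2Q F.fe.base ((fam2Q cc).get j) 1 = true).card) &&
    decide (Even (U.filter fun j => bitRow2Q F.fe.base ((fam2Q cc).get j) 2 = true).card) &&
    decide (Even (U.filter fun j => bitRow2Q F.fe.base ((fam2Q cc).get j) 3 = true).card) &&
    decide (Even (U.filter fun j => bitRow2Q F.fe.base ((fam2Q cc).get j) 4 = true).card)

/-! ### Kill records over the two-view family (validity form) -/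

/-- `α`-coordinates of `X_j = m₁ · x_j` for the members of the family, as a `Fin`-family. [folklore] -/
def famCoords2Q : Fin (fam2Q cc).length → ℤ × ℤ × ℤ := fun j => ((fam2Q cc).get j).X

/-- The class of a raw kill as a `Finset` of family indices. [folklore] -/
def ClKill.cls2Q (k : ClKill) : Finset (Fin (fam2Q cc).length) :=
  Finset.univ.filter fun j : Fin (fam2Q cc).length => j.val ∈ k.U

/-- The representative `z = ∏_{j ∈ U} X_j` of a killed class in `α`-coordinates. [folklore] -/
def ClKill.z2Q (k : ClKill) : ℤ × ℤ × ℤ :=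
  prodCoords F.fe.base.a F.fe.base.b F.fe.base.c noUnitCoords (famCoords2Q cc) ∅ (k.cls2Q cc)

/-- A raw kill as a `KillEntry` over the family coordinates. [folklore] -/
def ClKill.toEntry2Q (k : ClKill) : KillEntry 0 (fam2Q cc).length := ⟨∅, k.cls2Q cc, k.z2Q F cc, k.p, k.fuel⟩

/-- The kill list of a row as `KillEntry`s. [folklore] -/
def killEntries2Q (ks : List ClKill) : List (KillEntry 0 (fam2Q cc).length) := ks.map (ClKill.toEntry2Q F cc)

/-- The sieve of a row with kills: `adm2Q F cc` minus the killed classes. [folklore] -/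
def admK2Q (ks : List ClKill) : Finset (Fin 0) → Finset (Fin (fam2Q cc).length) → Bool :=
  admKills (adm2Q F cc) (killEntries2Q F cc ks)

/-- **Light kill clause, validity form**: `z ≠ 0` and the class is not the trivial class. Computable. [folklore] -/
def ClKill.liteV2Q (k : ClKill) : Bool :=
  decide (k.z2Q F cc ≠ ((0 : ℤ), (0 : ℤ), (0 : ℤ))) && decide (k.cls2Q cc ≠ ∅)

/-- **The kills of a row, validity form**: every raw kill is at a prime `p` and the quadric pair of its class has
no integer zero primitive at `p` (`TwoDescKill.KillValidAt`, at the `α`-coordinates `(t₁, t₂)` of `X_t = m₁·e`).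
A hypothesis of the soundness theorem, discharged kill by kill by ANY certificate form. [cite: CremonaAlgorithms1997, §3.6] -/
def KillValidE2Q (ks : List ClKill) : Prop :=
  ∀ k ∈ ks, k.p.Prime ∧ KillValidAt k.p F.fe.base.a F.fe.base.b F.fe.base.c (k.z2Q F cc) cc.Xt.2.1 cc.Xt.2.2

/-- **The two-view two-prime per-curve `r`-checker with a kill list (validity form).** `Δ ≠ 0`; `F` irreducible
mod `pF`; `F_{m₁}(X_t) = 0`, `F′` consistency; two-view consistency of `e` and `D`; `Δ(F) < 0`; `N(X_D) ≠ 0` and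
`|N(X_D)| = ∏ p^e` dispatched; the support codes; `X_D ∉ W₁₁, W₁₂, W₂₁, W₂₂`; `Q > 0`; six head entries;
`famCheckE2Q` of the family; the parity certificate; the light kill clauses; FEWER THAN `2^(r+1)` classes pass
`admK2Q`.  Computable; run by `decide +kernel`. [cite: Cassels1991LecturesEllipticCurves, §15] [cite: CremonaAlgorithms1997, §3.6] -/
def checkE2Q (r : ℕ) (ks : List ClKill) : Bool :=
  decide (deltaShort cc.A cc.B cc.C ≠ 0) &&
    noRootMod cc.pF cc.A cc.B cc.C &&
    decide (cubicAtCoords F.fe.base.a F.fe.base.b F.fe.base.c ((F.m₁ : ℤ) * cc.A) ((F.m₁ : ℤ) ^ 2 * cc.B)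
      ((F.m₁ : ℤ) ^ 3 * cc.C) cc.Xt = (0, 0, 0)) &&
    decide (derivAtCoords F.fe.base.a F.fe.base.b F.fe.base.c ((F.m₁ : ℤ) * cc.A) ((F.m₁ : ℤ) ^ 2 * cc.B) cc.Xt =
      MonicCubic.mulCoords F.fe.base.a F.fe.base.b F.fe.base.c (smulCoords (F.m₁ : ℤ) cc.XD)
        (prodPowCoords F.fe.base.a F.fe.base.b F.fe.base.c [])) &&
    twoViewCheck F.fe.base.a F.fe.base.b F.fe.base.c F.fe.u F.fe.d F.m₁ F.m₂ cc.Xt cc.Yt &&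
    twoViewCheck F.fe.base.a F.fe.base.b F.fe.base.c F.fe.u F.fe.d F.m₁ F.m₂ cc.XD cc.YD &&
    decide (MonicCubic.disc cc.A cc.B cc.C < 0) &&
    decide (normFormZ F.fe.base.a F.fe.base.b F.fe.base.c cc.XD.1 cc.XD.2.1 cc.XD.2.2 ≠ 0) &&
    decide ((normFormZ F.fe.base.a F.fe.base.b F.fe.base.c cc.XD.1 cc.XD.2.1 cc.XD.2.2).natAbs =
      (cc.dn.map fun pe => pe.1 ^ pe.2).prod) &&
    (cc.dn.all fun pe => primeDispatchQ F cc cc.XD cc.YD cc.dinvA cc.dinvE pe.1) &&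
    (cc.codes.all fun bc => codeClauseQ F cc bc) &&
    invCert F.fe.base.a F.fe.base.b F.fe.base.c F.fe.base.w₁₁ cc.XD cc.dW11 &&
    invCert F.fe.base.a F.fe.base.b F.fe.base.c F.fe.base.w₁₂ cc.XD cc.dW12 &&
    invCert F.fe.base.a F.fe.base.b F.fe.base.c F.fe.base.w₂₁ cc.XD cc.dW21 &&
    invCert F.fe.base.a F.fe.base.b F.fe.base.c F.fe.base.w₂₂ cc.XD cc.dW22 &&
    (cc.Q.all fun q => decide (0 < q)) &&
    decide (cc.head.length = 6) &&
    ((fam2Q cc).all fun f => famCheckE2Q F cc f) &&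
    decide (∀ T : Finset (Fin (fam2Q cc).length), T ≠ ∅ →
      ∃ k : Fin (F.fe.base.chars.length + 5), Odd (T.filter fun j => bit2Q F cc k j = true).card) &&
    (ks.all fun k => k.liteV2Q F cc) &&
    decide (((Finset.univ ×ˢ Finset.univ).filter
      (fun p : Finset (Fin 0) × Finset (Fin (fam2Q cc).length) => admK2Q F cc ks p.1 p.2 = true)).card <
        2 ^ (r + 1))

variable {F cc}

/-- The light clauses and the primality of the kill primes give the validity-form list certificate
`killListCheckV` (the product clause holds by `rfl`). [folklore] -/
theorem killListCheckV_of_liteV2Q {ks : List ClKill} (hl : ∀ k ∈ ks, k.liteV2Q F cc = true)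
    (hk : KillValidE2Q F cc ks) :
    killListCheckV F.fe.base.a F.fe.base.b F.fe.base.c noUnitCoords (famCoords2Q cc) (killEntries2Q F cc ks) =
      true := by
  rw [killListCheckV, List.all_eq_true]
  intro e he
  obtain ⟨k, hkm, rfl⟩ := List.mem_map.mp he
  have h := hl k hkm
  simp only [ClKill.liteV2Q, Bool.and_eq_true, decide_eq_true_eq] at h
  obtain ⟨hz, -⟩ := h
  simp only [ClKill.toEntry2Q, Bool.and_eq_true, decide_eq_true_eq]
  exact ⟨⟨(hk k hkm).1, rfl⟩, hz⟩

/-- The validity of every `KillEntry` of the row. [folklore] -/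
theorem killValid_entries_of_killValidE2Q {ks : List ClKill} (hk : KillValidE2Q F cc ks) :
    ∀ e ∈ killEntries2Q F cc ks,
      KillValidAt e.p F.fe.base.a F.fe.base.b F.fe.base.c e.z cc.Xt.2.1 cc.Xt.2.2 := by
  intro e he
  obtain ⟨k, hkm, rfl⟩ := List.mem_map.mp he
  exact (hk k hkm).2

/-- No listed class is the trivial class. [folklore] -/
theorem noTrivial_of_liteV2Q {ks : List ClKill} (hl : ∀ k ∈ ks, k.liteV2Q F cc = true) :
    ((killEntries2Q F cc ks).all fun e => !(decide (e.T = ∅) && decide (e.U = ∅))) = true := by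
  rw [List.all_eq_true]
  intro e he
  obtain ⟨k, hkm, rfl⟩ := List.mem_map.mp he
  have h := hl k hkm
  simp only [ClKill.liteV2Q, Bool.and_eq_true, decide_eq_true_eq] at h
  simp [ClKill.toEntry2Q, h.2]

end Checkers
end Summit.BirchSwinnertonDyer.BirchSwinnertonDyer.Rank2Observatory.TwoDescCl
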